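import Summits.BirchSwinnertonDyer.Rank1Residual.X2.RouteGSplitDisplay92850e1
import Summits.BirchSwinnertonDyer.Rank1Residual.X2.RouteGSplitDisplay93504b1
import Summits.BirchSwinnertonDyer.Rank1Residual.X2.RouteGSplitDisplay110352bg1
import Summits.BirchSwinnertonDyer.Rank1Residual.X2.CongruenceTransferCoveredNonsplitAtThree
import HarnessLib

/-!
# Route G at a NON-SPLIT multiplicative Eisenstein `3`, COVERED relative — RE-DISPLAYS ON THE TYPED `p = 3` TIER, batch 02/12
# (cell `bsd-litref`, sub-dir `bstw24`, seat `bsd-litref-bstw24-pv` = the T2b prover; THEOREMS ONLY; generated by `work/gen_atthree.py`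
# from the landed part-2 displays — below the module docstring nothing is hand-edited)

HONEST FRAMING (programme BSD-LIT2PART v1 §T2 / §HONESTY; cell README): nothing here proves BSD for any curve; no label moves;
nothing is booked. For each T-EISRG3C `(class, 3)` cell of row A10 below (corner X2: `E[3]` reducible, NON-split multiplicative at
`3`, `r = 0`, ¬GVPar; register entry `T-EISRG3C:CGS25-ThmA-Thm4.1.1@BSTW24-§5(arXiv:2409.01350,preprint;read)@3`, referee A R299.5,
B R252.4 / R291 / R344 / R348) the landed display `X2/RouteGSplitDisplay<T>.lean` closes `X2.MazurMainConjectureAt W 3` / `BSDp W 3`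
on the binder `hA : CastellaGrossiSkinner2025.thmA_charIdeal_eq_padicLFunction` — CGS25 Thm A, Math. Ann. 393 (2025), a PUBLISHED
statement for every `p > 2` whose printed proof AT `p = 3` rests on Thm 4.1.1 ⇐ [BSTW24, §5] ⇐ [KLZ17] §§7–10 (printed `p ≥ 5`) +
Ohta's Λ-adic Eichler–Shimura for the open tower ⇐ [SV-S-Ohta] (unpublished): the in-cell referees' concurring GAP(line)
(D-AUDIT-bstw24-r1 2ab68891cb7b08bc O3; D-AUDIT-bstw24-r2 69e4de3690fd21dc N1; TeX l.2915, l.4918–4922). Reader 1's §5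
recommendation in three landed steps: gap TYPED as ONE claim-tagged binder at the cells' prime (`RowC6.CastellaGrossiSkinner2025_thmA_atThree_OPEN`,
p461118) → the three non-split heads RE-ROUTED onto it (`X2/CongruenceTransferCoveredNonsplitAtThree.lean`, p464694) → THIS FILE:
the displays re-displayed with `hA ↦ hA3` and NOTHING else changed (same per-pair instrument certificates `hμ0 hlam hμ0' hlam' hk hn
(hr)`, same registered [PUB] facts; part 1 and the part-2 lemmas `good_outside_S₀` / `sum_delta` consumed BY NAME; only the
`S₀`-membership lemma, private in part 2, is re-proved). Each cell then reads in the kernel modulo {PUBLISHED named facts} + ONE named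
PRE binder carrying exactly the located gap (the register's component attached to a DECL: director ruling (i) / referee C R263), and
is NEVER a stronger claim than the booked display (`X2.mazurMainConjectureAt_of_coveredRelativeAtThree_of_not_split_of_thmA`).
Cells with an hA-free twin in tree (OFFER-EIS-A10NONSPLIT-B9) are not re-displayed. PARTITION (D-0054): row A10 × T-EISRG3C —
0 classes move (same literal tier; strike condition unchanged: a public Λ-adic Eichler–Shimura + [KLZ] §§7–10 at `p = 3`, whereupon
`hA3` is discharged by `RowC6.thmA_atThree_OPEN_of_thmA`). bears_on: LADDER-BSD H0/H1 · K5 (A10).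
Cells in this batch: `92850e1 ← 201175a1` (R252.4/B5/B6 (hA-only; no B9 twin)); `93504b1 ← 155840r1` (R252.4/B5/B6 (hA-only; no B9 twin)); `110352bg1 ← 36784bj1` (R252.4/B5/B6 (hA-only; no B9 twin)).
References: [CastellaGrossiSkinner2025] Thm A (= 7.1.1), Thm 4.1.1; [BurungaleSkinnerTianWan2024] §5 (PRE); [GreenbergVatsal2000]
Thm (1.4), §2 Prop (2.4); [Wuthrich2014] Thm 16; [SteinWuthrich2013] Thm 6.1; [Fisher2012Hessian] §13; sheets as above (+ ADD-1
dd57a5d99fb5bd7f / 850c38dd32e26b8a); `pub/bsd-litref/bstw24/staging/bsd-litref-bstw24-pv/CONSUMERS.md` §1, `PRICING-A10-TEISRG3C-DRAFT.md` §iii-0.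
-/

set_option autoImplicit false

noncomputable section

open scoped Classical

open WeierstrassCurve NumberField IsDedekindDomain
  Literature.NumberTheory.EllipticCurves
  Literature.NumberTheory.EllipticCurves.ModularForms
  Literature.NumberTheory.EllipticCurves.Rank1Residual
  Literature.NumberTheory.EllipticCurves.Rank1Residual.Typed
  Literature.NumberTheory.EllipticCurves.Rank1Residual.X11RankOneCertificates
  Literature.NumberTheory.EllipticCurves.Wuthrich2014
  Literature.NumberTheory.EllipticCurves.SteinWuthrich2013
  Literature.NumberTheory.EllipticCurves.Greenberg1999
  Literature.NumberTheory.EllipticCurves.GreenbergVatsal2000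
  Summit.BirchSwinnertonDyer.BirchSwinnertonDyer.Rank1Residual.IntModel
  Summit.BirchSwinnertonDyer.BirchSwinnertonDyer.Rank1Residual.X11RankOne
  Summit.BirchSwinnertonDyer.Rank1Residual.X11b
  Summit.BirchSwinnertonDyer.Rank1Residual.X1.CongruenceTransfer
  Summit.BirchSwinnertonDyer.Rank1Residual.X2.LocalDeltaCalculus
  Summit.BirchSwinnertonDyer.Rank1Residual
  Literature.NumberTheory.EllipticCurves.CastellaGrossiSkinner2025

namespace Summit.BirchSwinnertonDyer.Rank1Residual.X2.RouteGSplitDisplay92850e1AtThree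

open Summit.BirchSwinnertonDyer.Rank1Residual.X2.RouteGSplitDisplay92850e1Local

/-! ## Cell `92850e1 @ 3 ← 201175a1 @ 3` (R252.4/B5/B6 (hA-only; no B9 twin)) — `S₀`-membership (re-proved; private in part 2), then the two re-displays -/

/-- **`3 ∉ v` for `v ∈ S₀`.** [folklore] -/
private theorem three_not_mem_of_mem_S₀ :
    ∀ v ∈ ({((Rat.HeightOneSpectrum.primesEquiv (R := 𝓞 ℚ)).symm ⟨2, Nat.prime_two⟩),
      ((Rat.HeightOneSpectrum.primesEquiv (R := 𝓞 ℚ)).symm ⟨5, by norm_num⟩),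
      ((Rat.HeightOneSpectrum.primesEquiv (R := 𝓞 ℚ)).symm ⟨13, by norm_num⟩),
      ((Rat.HeightOneSpectrum.primesEquiv (R := 𝓞 ℚ)).symm ⟨619, by norm_num⟩)} : Finset (HeightOneSpectrum (𝓞 ℚ))),
      ((3 : ℕ) : 𝓞 ℚ) ∉ v.asIdeal := by
  intro v hv h3
  have h := Rat.HeightOneSpectrum.primesEquiv_eq_of_natCast_mem v (by norm_num) h3
  simp only [Finset.mem_insert, Finset.mem_singleton] at hv
  rcases hv with rfl | rfl | rfl | rfl <;> simp at h


/-- **RE-DISPLAY of `RouteGSplitDisplay92850e1.mazurMainConjectureAt_92850e1_at_three` ON THE TYPED `p = 3` TIER: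
`X2.MazurMainConjectureAt 92850e1 3`** from the SAME inputs with the published binder `hA` (CGS25 Thm A, all `p > 2`)
replaced by the `p = 3` binder `hA3 : RowC6.CastellaGrossiSkinner2025_thmA_atThree_OPEN` (the in-cell referees'
located GAP(line) typed BY NAME, p461118), through the re-routed head
`X2.mazurMainConjectureAt_of_coveredRelativeAtThree_of_not_split` (p464694); relative `201175a1` (good ordinary,
`3`-reducible, non-anomalous: part 1); `good_outside_S₀` / `sum_delta` = the landed part 2 BY NAME. Same literal tier,
honest binder, never stronger than the booked display. CONDITIONAL on `hA3` + the per-pair certificates; closes nothing.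
[claim: BurungaleSkinnerTianWan2024, status: under-review]
[cite: GreenbergVatsal2000, Thm. (1.4), §1 (5)–(7), §2 Prop. (2.4) pp. 20–27] [cite: Wuthrich2014, Thm. 16 (p. 397)] -/
theorem mazurMainConjectureAt_92850e1_atThree_OPEN
    (hA3 : RowC6.CastellaGrossiSkinner2025_thmA_atThree_OPEN)
    (hWu : thm16_charIdeal_dvd_multiplicative_of_reducible)
    (hW16 : Wuthrich2014.charIdeal_dvd_padicLFunction)
    (hpar : nonempty_modularParametrizationData)
    (hT : Silverman1994_thmV53_corV54_tateUniformisation.{0})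
    (hT' : Silverman1994_thmV53_tateUniformisation.{0})
    (hAm : lambda_nonPrimitive_eq_add_sum_delta_multiplicative)
    (hBm : datumSelmer_divisible_of_finite_torsionBy) (hF : datumStrictSelmer_lt_datumSelmer_of_split)
    (hGV : imKummer_ge_greenbergCondition_at_p) (hA7 : lambda_nonPrimitive_eq_add_sum_delta)
    (hB : divisible_nonPrimitiveSelmerInfty_of_mu_eq_zero)
    (W W' : WeierstrassCurve ℚ) [W.IsElliptic] [W.IsGloballyMinimal] [W'.IsElliptic]
    [W'.IsGloballyMinimal] (hW : W = ⟨1, 1, 0, 12067975, -41983654875⟩)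
    (hW' : W' = ⟨0, -1, 1, -22283, 1287843⟩)
    (n n' k : ℕ) (hμ0 : AnalyticMuLE W 3 0) (hlam : AnalyticLambdaEq W 3 n)
    (hμ0' : X1.MuPart.AnalyticMuLE W' 3 0) (hlam' : X1.ParitySqueeze.AnalyticLambdaEq W' 3 n')
    (hk : (k : ℤ) = n' + (0)) (hn : n ≤ k) :
    X2.MazurMainConjectureAt W 3 := by
  have hδ := RouteGSplitDisplay92850e1.sum_delta W W' hW hW'
  subst hW hW'
  have hp3 : (3 : ℕ) = 3 := rfl
  obtain ⟨hmult, hns⟩ := nonsplit_92850e1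
  obtain ⟨hgood', hna'⟩ := goodNonAnom_201175a1
  have hk' : (k : ℤ) = n' + ∑ v ∈ ({((Rat.HeightOneSpectrum.primesEquiv (R := 𝓞 ℚ)).symm ⟨2, Nat.prime_two⟩),
      ((Rat.HeightOneSpectrum.primesEquiv (R := 𝓞 ℚ)).symm ⟨5, by norm_num⟩),
      ((Rat.HeightOneSpectrum.primesEquiv (R := 𝓞 ℚ)).symm ⟨13, by norm_num⟩),
      ((Rat.HeightOneSpectrum.primesEquiv (R := 𝓞 ℚ)).symm ⟨619, by norm_num⟩)} : Finset (HeightOneSpectrum (𝓞 ℚ))),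
      ((delta (⟨0, -1, 1, -22283, 1287843⟩ : WeierstrassCurve ℚ) 3 v : ℤ) - (delta (⟨1, 1, 0, 12067975, -41983654875⟩ : WeierstrassCurve ℚ) 3 v : ℤ)) := by
    rw [hδ]; exact hk
  exact mazurMainConjectureAt_of_coveredRelativeAtThree_of_not_split _ hA3 hWu hW16 hpar hT hT' hAm hBm hF hGV hA7 hB
    hp3 hmult hns not_irreducible_92850e1 hμ0 hlam hgood' hna' hμ0' hlam' three_not_mem_of_mem_S₀
    (fun v hv h3 ↦ (RouteGSplitDisplay92850e1.good_outside_S₀ v hv h3).1) (fun v hv h3 ↦ (RouteGSplitDisplay92850e1.good_outside_S₀ v hv h3).2)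
    torsionIso_92850e1_201175a1 hk' hn

/-- **RE-DISPLAY of `RouteGSplitDisplay92850e1.bsdp_92850e1_at_three` ON THE TYPED `p = 3` TIER: `BSDp 92850e1 3`** — as
`mazurMainConjectureAt_92850e1_atThree_OPEN` plus Stein–Wuthrich, Greenberg–Stevens, GZK, modularity and the rank-`0`
certificate, through `X2.bsdp_of_coveredRelativeAtThree_rankZero_of_not_split` (p464694); binder `hA ↦ hA3`, nothing else
changed. CONDITIONAL on `hA3` + the per-pair instrument certificates; closes nothing; books nothing.
[claim: BurungaleSkinnerTianWan2024, status: under-review]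
[cite: GreenbergVatsal2000, Thm. (1.4), §2 Prop. (2.4)] [cite: Wuthrich2014, Thm. 16 (p. 397)]
[cite: SteinWuthrich2013, Thm. 6.1 (p. 20)] [cite: MazurTateTeitelbaum1986Invent, Ch. II §10 Conjecture (BSD(p)) (p. 38)]
[cite: Miller2011LMS, Def. 1.1] -/
theorem bsdp_92850e1_atThree_OPEN
    (hA3 : RowC6.CastellaGrossiSkinner2025_thmA_atThree_OPEN)
    (hWu : thm16_charIdeal_dvd_multiplicative_of_reducible)
    (hW16 : Wuthrich2014.charIdeal_dvd_padicLFunction)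
    (hJs : thm61_splitMultiplicative) (hJn : thm61_nonsplitMultiplicative)
    (hHs : exists_isSplitMultCanonical) (hHn : exists_isMultCanonical)
    (hGZK : rank_eq_analyticRank_of_analyticRank_le_one) (hmod : hasEntireLFunction_rat)
    (hpar : nonempty_modularParametrizationData)
    (hT : Silverman1994_thmV53_corV54_tateUniformisation.{0})
    (hT' : Silverman1994_thmV53_tateUniformisation.{0})
    (hAm : lambda_nonPrimitive_eq_add_sum_delta_multiplicative)
    (hBm : datumSelmer_divisible_of_finite_torsionBy) (hF : datumStrictSelmer_lt_datumSelmer_of_split)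
    (hGV : imKummer_ge_greenbergCondition_at_p) (hA7 : lambda_nonPrimitive_eq_add_sum_delta)
    (hB : divisible_nonPrimitiveSelmerInfty_of_mu_eq_zero)
    (W W' : WeierstrassCurve ℚ) [W.IsElliptic] [W.IsGloballyMinimal] [W'.IsElliptic]
    [W'.IsGloballyMinimal] (hW : W = ⟨1, 1, 0, 12067975, -41983654875⟩)
    (hW' : W' = ⟨0, -1, 1, -22283, 1287843⟩)
    (hGS : greenberg_stevens (W := W) (p := 3))
    (hr : W.analyticRank = 0)
    (n n' k : ℕ) (hμ0 : AnalyticMuLE W 3 0) (hlam : AnalyticLambdaEq W 3 n)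
    (hμ0' : X1.MuPart.AnalyticMuLE W' 3 0) (hlam' : X1.ParitySqueeze.AnalyticLambdaEq W' 3 n')
    (hk : (k : ℤ) = n' + (0)) (hn : n ≤ k) :
    BSDp W 3 := by
  have hδ := RouteGSplitDisplay92850e1.sum_delta W W' hW hW'
  subst hW hW'
  have hp3 : (3 : ℕ) = 3 := rfl
  obtain ⟨hmult, hns⟩ := nonsplit_92850e1
  obtain ⟨hgood', hna'⟩ := goodNonAnom_201175a1
  have hk' : (k : ℤ) = n' + ∑ v ∈ ({((Rat.HeightOneSpectrum.primesEquiv (R := 𝓞 ℚ)).symm ⟨2, Nat.prime_two⟩),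
      ((Rat.HeightOneSpectrum.primesEquiv (R := 𝓞 ℚ)).symm ⟨5, by norm_num⟩),
      ((Rat.HeightOneSpectrum.primesEquiv (R := 𝓞 ℚ)).symm ⟨13, by norm_num⟩),
      ((Rat.HeightOneSpectrum.primesEquiv (R := 𝓞 ℚ)).symm ⟨619, by norm_num⟩)} : Finset (HeightOneSpectrum (𝓞 ℚ))),
      ((delta (⟨0, -1, 1, -22283, 1287843⟩ : WeierstrassCurve ℚ) 3 v : ℤ) - (delta (⟨1, 1, 0, 12067975, -41983654875⟩ : WeierstrassCurve ℚ) 3 v : ℤ)) := by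
    rw [hδ]; exact hk
  exact bsdp_of_coveredRelativeAtThree_rankZero_of_not_split _ hA3 hWu hW16 hJs hJn hHs hHn hGZK hmod hpar hT hT' hAm
    hBm hF hGV hA7 hB _ _ 3 hGS hp3 hmult hns not_irreducible_92850e1 hr hμ0 hlam hgood' hna' hμ0' hlam'
    three_not_mem_of_mem_S₀ (fun v hv h3 ↦ (RouteGSplitDisplay92850e1.good_outside_S₀ v hv h3).1)
    (fun v hv h3 ↦ (RouteGSplitDisplay92850e1.good_outside_S₀ v hv h3).2) torsionIso_92850e1_201175a1 hk' hn

end Summit.BirchSwinnertonDyer.Rank1Residual.X2.RouteGSplitDisplay92850e1AtThree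

namespace Summit.BirchSwinnertonDyer.Rank1Residual.X2.RouteGSplitDisplay93504b1AtThree

open Summit.BirchSwinnertonDyer.Rank1Residual.X2.RouteGSplitDisplay93504b1Local

/-! ## Cell `93504b1 @ 3 ← 155840r1 @ 3` (R252.4/B5/B6 (hA-only; no B9 twin)) — `S₀`-membership (re-proved; private in part 2), then the two re-displays -/

/-- **`3 ∉ v` for `v ∈ S₀`.** [folklore] -/
private theorem three_not_mem_of_mem_S₀ :
    ∀ v ∈ ({((Rat.HeightOneSpectrum.primesEquiv (R := 𝓞 ℚ)).symm ⟨2, Nat.prime_two⟩),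
      ((Rat.HeightOneSpectrum.primesEquiv (R := 𝓞 ℚ)).symm ⟨5, by norm_num⟩),
      ((Rat.HeightOneSpectrum.primesEquiv (R := 𝓞 ℚ)).symm ⟨487, by norm_num⟩)} : Finset (HeightOneSpectrum (𝓞 ℚ))),
      ((3 : ℕ) : 𝓞 ℚ) ∉ v.asIdeal := by
  intro v hv h3
  have h := Rat.HeightOneSpectrum.primesEquiv_eq_of_natCast_mem v (by norm_num) h3
  simp only [Finset.mem_insert, Finset.mem_singleton] at hv
  rcases hv with rfl | rfl | rfl <;> simp at h


/-- **RE-DISPLAY of `RouteGSplitDisplay93504b1.mazurMainConjectureAt_93504b1_at_three` ON THE TYPED `p = 3` TIER: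
`X2.MazurMainConjectureAt 93504b1 3`** from the SAME inputs with the published binder `hA` (CGS25 Thm A, all `p > 2`)
replaced by the `p = 3` binder `hA3 : RowC6.CastellaGrossiSkinner2025_thmA_atThree_OPEN` (the in-cell referees'
located GAP(line) typed BY NAME, p461118), through the re-routed head
`X2.mazurMainConjectureAt_of_coveredRelativeAtThree_of_not_split` (p464694); relative `155840r1` (good ordinary,
`3`-reducible, non-anomalous: part 1); `good_outside_S₀` / `sum_delta` = the landed part 2 BY NAME. Same literal tier,
honest binder, never stronger than the booked display. CONDITIONAL on `hA3` + the per-pair certificates; closes nothing.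
[claim: BurungaleSkinnerTianWan2024, status: under-review]
[cite: GreenbergVatsal2000, Thm. (1.4), §1 (5)–(7), §2 Prop. (2.4) pp. 20–27] [cite: Wuthrich2014, Thm. 16 (p. 397)] -/
theorem mazurMainConjectureAt_93504b1_atThree_OPEN
    (hA3 : RowC6.CastellaGrossiSkinner2025_thmA_atThree_OPEN)
    (hWu : thm16_charIdeal_dvd_multiplicative_of_reducible)
    (hW16 : Wuthrich2014.charIdeal_dvd_padicLFunction)
    (hpar : nonempty_modularParametrizationData)
    (hT : Silverman1994_thmV53_corV54_tateUniformisation.{0})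
    (hT' : Silverman1994_thmV53_tateUniformisation.{0})
    (hAm : lambda_nonPrimitive_eq_add_sum_delta_multiplicative)
    (hBm : datumSelmer_divisible_of_finite_torsionBy) (hF : datumStrictSelmer_lt_datumSelmer_of_split)
    (hGV : imKummer_ge_greenbergCondition_at_p) (hA7 : lambda_nonPrimitive_eq_add_sum_delta)
    (hB : divisible_nonPrimitiveSelmerInfty_of_mu_eq_zero)
    (W W' : WeierstrassCurve ℚ) [W.IsElliptic] [W.IsGloballyMinimal] [W'.IsElliptic]
    [W'.IsGloballyMinimal] (hW : W = ⟨0, -1, 0, -1387393, -571460735⟩)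
    (hW' : W' = ⟨0, -1, 0, -2561, -1537535⟩)
    (n n' k : ℕ) (hμ0 : AnalyticMuLE W 3 0) (hlam : AnalyticLambdaEq W 3 n)
    (hμ0' : X1.MuPart.AnalyticMuLE W' 3 0) (hlam' : X1.ParitySqueeze.AnalyticLambdaEq W' 3 n')
    (hk : (k : ℤ) = n' + (0)) (hn : n ≤ k) :
    X2.MazurMainConjectureAt W 3 := by
  have hδ := RouteGSplitDisplay93504b1.sum_delta W W' hW hW'
  subst hW hW'
  have hp3 : (3 : ℕ) = 3 := rfl
  obtain ⟨hmult, hns⟩ := nonsplit_93504b1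
  obtain ⟨hgood', hna'⟩ := goodNonAnom_155840r1
  have hk' : (k : ℤ) = n' + ∑ v ∈ ({((Rat.HeightOneSpectrum.primesEquiv (R := 𝓞 ℚ)).symm ⟨2, Nat.prime_two⟩),
      ((Rat.HeightOneSpectrum.primesEquiv (R := 𝓞 ℚ)).symm ⟨5, by norm_num⟩),
      ((Rat.HeightOneSpectrum.primesEquiv (R := 𝓞 ℚ)).symm ⟨487, by norm_num⟩)} : Finset (HeightOneSpectrum (𝓞 ℚ))),
      ((delta (⟨0, -1, 0, -2561, -1537535⟩ : WeierstrassCurve ℚ) 3 v : ℤ) - (delta (⟨0, -1, 0, -1387393, -571460735⟩ : WeierstrassCurve ℚ) 3 v : ℤ)) := by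
    rw [hδ]; exact hk
  exact mazurMainConjectureAt_of_coveredRelativeAtThree_of_not_split _ hA3 hWu hW16 hpar hT hT' hAm hBm hF hGV hA7 hB
    hp3 hmult hns not_irreducible_93504b1 hμ0 hlam hgood' hna' hμ0' hlam' three_not_mem_of_mem_S₀
    (fun v hv h3 ↦ (RouteGSplitDisplay93504b1.good_outside_S₀ v hv h3).1) (fun v hv h3 ↦ (RouteGSplitDisplay93504b1.good_outside_S₀ v hv h3).2)
    torsionIso_93504b1_155840r1 hk' hn

/-- **RE-DISPLAY of `RouteGSplitDisplay93504b1.bsdp_93504b1_at_three` ON THE TYPED `p = 3` TIER: `BSDp 93504b1 3`** — as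
`mazurMainConjectureAt_93504b1_atThree_OPEN` plus Stein–Wuthrich, Greenberg–Stevens, GZK, modularity and the rank-`0`
certificate, through `X2.bsdp_of_coveredRelativeAtThree_rankZero_of_not_split` (p464694); binder `hA ↦ hA3`, nothing else
changed. CONDITIONAL on `hA3` + the per-pair instrument certificates; closes nothing; books nothing.
[claim: BurungaleSkinnerTianWan2024, status: under-review]
[cite: GreenbergVatsal2000, Thm. (1.4), §2 Prop. (2.4)] [cite: Wuthrich2014, Thm. 16 (p. 397)]
[cite: SteinWuthrich2013, Thm. 6.1 (p. 20)] [cite: MazurTateTeitelbaum1986Invent, Ch. II §10 Conjecture (BSD(p)) (p. 38)]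
[cite: Miller2011LMS, Def. 1.1] -/
theorem bsdp_93504b1_atThree_OPEN
    (hA3 : RowC6.CastellaGrossiSkinner2025_thmA_atThree_OPEN)
    (hWu : thm16_charIdeal_dvd_multiplicative_of_reducible)
    (hW16 : Wuthrich2014.charIdeal_dvd_padicLFunction)
    (hJs : thm61_splitMultiplicative) (hJn : thm61_nonsplitMultiplicative)
    (hHs : exists_isSplitMultCanonical) (hHn : exists_isMultCanonical)
    (hGZK : rank_eq_analyticRank_of_analyticRank_le_one) (hmod : hasEntireLFunction_rat)
    (hpar : nonempty_modularParametrizationData)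
    (hT : Silverman1994_thmV53_corV54_tateUniformisation.{0})
    (hT' : Silverman1994_thmV53_tateUniformisation.{0})
    (hAm : lambda_nonPrimitive_eq_add_sum_delta_multiplicative)
    (hBm : datumSelmer_divisible_of_finite_torsionBy) (hF : datumStrictSelmer_lt_datumSelmer_of_split)
    (hGV : imKummer_ge_greenbergCondition_at_p) (hA7 : lambda_nonPrimitive_eq_add_sum_delta)
    (hB : divisible_nonPrimitiveSelmerInfty_of_mu_eq_zero)
    (W W' : WeierstrassCurve ℚ) [W.IsElliptic] [W.IsGloballyMinimal] [W'.IsElliptic]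
    [W'.IsGloballyMinimal] (hW : W = ⟨0, -1, 0, -1387393, -571460735⟩)
    (hW' : W' = ⟨0, -1, 0, -2561, -1537535⟩)
    (hGS : greenberg_stevens (W := W) (p := 3))
    (hr : W.analyticRank = 0)
    (n n' k : ℕ) (hμ0 : AnalyticMuLE W 3 0) (hlam : AnalyticLambdaEq W 3 n)
    (hμ0' : X1.MuPart.AnalyticMuLE W' 3 0) (hlam' : X1.ParitySqueeze.AnalyticLambdaEq W' 3 n')
    (hk : (k : ℤ) = n' + (0)) (hn : n ≤ k) :
    BSDp W 3 := by
  have hδ := RouteGSplitDisplay93504b1.sum_delta W W' hW hW'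
  subst hW hW'
  have hp3 : (3 : ℕ) = 3 := rfl
  obtain ⟨hmult, hns⟩ := nonsplit_93504b1
  obtain ⟨hgood', hna'⟩ := goodNonAnom_155840r1
  have hk' : (k : ℤ) = n' + ∑ v ∈ ({((Rat.HeightOneSpectrum.primesEquiv (R := 𝓞 ℚ)).symm ⟨2, Nat.prime_two⟩),
      ((Rat.HeightOneSpectrum.primesEquiv (R := 𝓞 ℚ)).symm ⟨5, by norm_num⟩),
      ((Rat.HeightOneSpectrum.primesEquiv (R := 𝓞 ℚ)).symm ⟨487, by norm_num⟩)} : Finset (HeightOneSpectrum (𝓞 ℚ))),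
      ((delta (⟨0, -1, 0, -2561, -1537535⟩ : WeierstrassCurve ℚ) 3 v : ℤ) - (delta (⟨0, -1, 0, -1387393, -571460735⟩ : WeierstrassCurve ℚ) 3 v : ℤ)) := by
    rw [hδ]; exact hk
  exact bsdp_of_coveredRelativeAtThree_rankZero_of_not_split _ hA3 hWu hW16 hJs hJn hHs hHn hGZK hmod hpar hT hT' hAm
    hBm hF hGV hA7 hB _ _ 3 hGS hp3 hmult hns not_irreducible_93504b1 hr hμ0 hlam hgood' hna' hμ0' hlam'
    three_not_mem_of_mem_S₀ (fun v hv h3 ↦ (RouteGSplitDisplay93504b1.good_outside_S₀ v hv h3).1)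
    (fun v hv h3 ↦ (RouteGSplitDisplay93504b1.good_outside_S₀ v hv h3).2) torsionIso_93504b1_155840r1 hk' hn

end Summit.BirchSwinnertonDyer.Rank1Residual.X2.RouteGSplitDisplay93504b1AtThree

namespace Summit.BirchSwinnertonDyer.Rank1Residual.X2.RouteGSplitDisplay110352bg1AtThree

open Summit.BirchSwinnertonDyer.Rank1Residual.X2.RouteGSplitDisplay110352bg1Local

/-! ## Cell `110352bg1 @ 3 ← 36784bj1 @ 3` (R252.4/B5/B6 (hA-only; no B9 twin)) — `S₀`-membership (re-proved; private in part 2), then the two re-displays -/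

/-- **`3 ∉ v` for `v ∈ S₀`.** [folklore] -/
private theorem three_not_mem_of_mem_S₀ :
    ∀ v ∈ ({((Rat.HeightOneSpectrum.primesEquiv (R := 𝓞 ℚ)).symm ⟨2, Nat.prime_two⟩),
      ((Rat.HeightOneSpectrum.primesEquiv (R := 𝓞 ℚ)).symm ⟨11, by norm_num⟩),
      ((Rat.HeightOneSpectrum.primesEquiv (R := 𝓞 ℚ)).symm ⟨19, by norm_num⟩)} : Finset (HeightOneSpectrum (𝓞 ℚ))),
      ((3 : ℕ) : 𝓞 ℚ) ∉ v.asIdeal := by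
  intro v hv h3
  have h := Rat.HeightOneSpectrum.primesEquiv_eq_of_natCast_mem v (by norm_num) h3
  simp only [Finset.mem_insert, Finset.mem_singleton] at hv
  rcases hv with rfl | rfl | rfl <;> simp at h


/-- **RE-DISPLAY of `RouteGSplitDisplay110352bg1.mazurMainConjectureAt_110352bg1_at_three` ON THE TYPED `p = 3` TIER:
`X2.MazurMainConjectureAt 110352bg1 3`** from the SAME inputs with the published binder `hA` (CGS25 Thm A, all `p > 2`)
replaced by the `p = 3` binder `hA3 : RowC6.CastellaGrossiSkinner2025_thmA_atThree_OPEN` (the in-cell referees'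
located GAP(line) typed BY NAME, p461118), through the re-routed head
`X2.mazurMainConjectureAt_of_coveredRelativeAtThree_of_not_split` (p464694); relative `36784bj1` (good ordinary,
`3`-reducible, non-anomalous: part 1); `good_outside_S₀` / `sum_delta` = the landed part 2 BY NAME. Same literal tier,
honest binder, never stronger than the booked display. CONDITIONAL on `hA3` + the per-pair certificates; closes nothing.
[claim: BurungaleSkinnerTianWan2024, status: under-review]
[cite: GreenbergVatsal2000, Thm. (1.4), §1 (5)–(7), §2 Prop. (2.4) pp. 20–27] [cite: Wuthrich2014, Thm. 16 (p. 397)] -/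
theorem mazurMainConjectureAt_110352bg1_atThree_OPEN
    (hA3 : RowC6.CastellaGrossiSkinner2025_thmA_atThree_OPEN)
    (hWu : thm16_charIdeal_dvd_multiplicative_of_reducible)
    (hW16 : Wuthrich2014.charIdeal_dvd_padicLFunction)
    (hpar : nonempty_modularParametrizationData)
    (hT : Silverman1994_thmV53_corV54_tateUniformisation.{0})
    (hT' : Silverman1994_thmV53_tateUniformisation.{0})
    (hAm : lambda_nonPrimitive_eq_add_sum_delta_multiplicative)
    (hBm : datumSelmer_divisible_of_finite_torsionBy) (hF : datumStrictSelmer_lt_datumSelmer_of_split)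
    (hGV : imKummer_ge_greenbergCondition_at_p) (hA7 : lambda_nonPrimitive_eq_add_sum_delta)
    (hB : divisible_nonPrimitiveSelmerInfty_of_mu_eq_zero)
    (W W' : WeierstrassCurve ℚ) [W.IsElliptic] [W.IsGloballyMinimal] [W'.IsElliptic]
    [W'.IsGloballyMinimal] (hW : W = ⟨0, -1, 0, -703413, -244556739⟩)
    (hW' : W' = ⟨0, -1, 0, 1291, -1219⟩)
    (n n' k : ℕ) (hμ0 : AnalyticMuLE W 3 0) (hlam : AnalyticLambdaEq W 3 n)
    (hμ0' : X1.MuPart.AnalyticMuLE W' 3 0) (hlam' : X1.ParitySqueeze.AnalyticLambdaEq W' 3 n')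
    (hk : (k : ℤ) = n' + (0)) (hn : n ≤ k) :
    X2.MazurMainConjectureAt W 3 := by
  have hδ := RouteGSplitDisplay110352bg1.sum_delta W W' hW hW'
  subst hW hW'
  have hp3 : (3 : ℕ) = 3 := rfl
  obtain ⟨hmult, hns⟩ := nonsplit_110352bg1
  obtain ⟨hgood', hna'⟩ := goodNonAnom_36784bj1
  have hk' : (k : ℤ) = n' + ∑ v ∈ ({((Rat.HeightOneSpectrum.primesEquiv (R := 𝓞 ℚ)).symm ⟨2, Nat.prime_two⟩),
      ((Rat.HeightOneSpectrum.primesEquiv (R := 𝓞 ℚ)).symm ⟨11, by norm_num⟩),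
      ((Rat.HeightOneSpectrum.primesEquiv (R := 𝓞 ℚ)).symm ⟨19, by norm_num⟩)} : Finset (HeightOneSpectrum (𝓞 ℚ))),
      ((delta (⟨0, -1, 0, 1291, -1219⟩ : WeierstrassCurve ℚ) 3 v : ℤ) - (delta (⟨0, -1, 0, -703413, -244556739⟩ : WeierstrassCurve ℚ) 3 v : ℤ)) := by
    rw [hδ]; exact hk
  exact mazurMainConjectureAt_of_coveredRelativeAtThree_of_not_split _ hA3 hWu hW16 hpar hT hT' hAm hBm hF hGV hA7 hB
    hp3 hmult hns not_irreducible_110352bg1 hμ0 hlam hgood' hna' hμ0' hlam' three_not_mem_of_mem_S₀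
    (fun v hv h3 ↦ (RouteGSplitDisplay110352bg1.good_outside_S₀ v hv h3).1) (fun v hv h3 ↦ (RouteGSplitDisplay110352bg1.good_outside_S₀ v hv h3).2)
    torsionIso_110352bg1_36784bj1 hk' hn

/-- **RE-DISPLAY of `RouteGSplitDisplay110352bg1.bsdp_110352bg1_at_three` ON THE TYPED `p = 3` TIER: `BSDp 110352bg1 3`** — as
`mazurMainConjectureAt_110352bg1_atThree_OPEN` plus Stein–Wuthrich, Greenberg–Stevens, GZK, modularity and the rank-`0`
certificate, through `X2.bsdp_of_coveredRelativeAtThree_rankZero_of_not_split` (p464694); binder `hA ↦ hA3`, nothing else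
changed. CONDITIONAL on `hA3` + the per-pair instrument certificates; closes nothing; books nothing.
[claim: BurungaleSkinnerTianWan2024, status: under-review]
[cite: GreenbergVatsal2000, Thm. (1.4), §2 Prop. (2.4)] [cite: Wuthrich2014, Thm. 16 (p. 397)]
[cite: SteinWuthrich2013, Thm. 6.1 (p. 20)] [cite: MazurTateTeitelbaum1986Invent, Ch. II §10 Conjecture (BSD(p)) (p. 38)]
[cite: Miller2011LMS, Def. 1.1] -/
theorem bsdp_110352bg1_atThree_OPEN
    (hA3 : RowC6.CastellaGrossiSkinner2025_thmA_atThree_OPEN)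
    (hWu : thm16_charIdeal_dvd_multiplicative_of_reducible)
    (hW16 : Wuthrich2014.charIdeal_dvd_padicLFunction)
    (hJs : thm61_splitMultiplicative) (hJn : thm61_nonsplitMultiplicative)
    (hHs : exists_isSplitMultCanonical) (hHn : exists_isMultCanonical)
    (hGZK : rank_eq_analyticRank_of_analyticRank_le_one) (hmod : hasEntireLFunction_rat)
    (hpar : nonempty_modularParametrizationData)
    (hT : Silverman1994_thmV53_corV54_tateUniformisation.{0})
    (hT' : Silverman1994_thmV53_tateUniformisation.{0})
    (hAm : lambda_nonPrimitive_eq_add_sum_delta_multiplicative)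
    (hBm : datumSelmer_divisible_of_finite_torsionBy) (hF : datumStrictSelmer_lt_datumSelmer_of_split)
    (hGV : imKummer_ge_greenbergCondition_at_p) (hA7 : lambda_nonPrimitive_eq_add_sum_delta)
    (hB : divisible_nonPrimitiveSelmerInfty_of_mu_eq_zero)
    (W W' : WeierstrassCurve ℚ) [W.IsElliptic] [W.IsGloballyMinimal] [W'.IsElliptic]
    [W'.IsGloballyMinimal] (hW : W = ⟨0, -1, 0, -703413, -244556739⟩)
    (hW' : W' = ⟨0, -1, 0, 1291, -1219⟩)
    (hGS : greenberg_stevens (W := W) (p := 3))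
    (hr : W.analyticRank = 0)
    (n n' k : ℕ) (hμ0 : AnalyticMuLE W 3 0) (hlam : AnalyticLambdaEq W 3 n)
    (hμ0' : X1.MuPart.AnalyticMuLE W' 3 0) (hlam' : X1.ParitySqueeze.AnalyticLambdaEq W' 3 n')
    (hk : (k : ℤ) = n' + (0)) (hn : n ≤ k) :
    BSDp W 3 := by
  have hδ := RouteGSplitDisplay110352bg1.sum_delta W W' hW hW'
  subst hW hW'
  have hp3 : (3 : ℕ) = 3 := rfl
  obtain ⟨hmult, hns⟩ := nonsplit_110352bg1
  obtain ⟨hgood', hna'⟩ := goodNonAnom_36784bj1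
  have hk' : (k : ℤ) = n' + ∑ v ∈ ({((Rat.HeightOneSpectrum.primesEquiv (R := 𝓞 ℚ)).symm ⟨2, Nat.prime_two⟩),
      ((Rat.HeightOneSpectrum.primesEquiv (R := 𝓞 ℚ)).symm ⟨11, by norm_num⟩),
      ((Rat.HeightOneSpectrum.primesEquiv (R := 𝓞 ℚ)).symm ⟨19, by norm_num⟩)} : Finset (HeightOneSpectrum (𝓞 ℚ))),
      ((delta (⟨0, -1, 0, 1291, -1219⟩ : WeierstrassCurve ℚ) 3 v : ℤ) - (delta (⟨0, -1, 0, -703413, -244556739⟩ : WeierstrassCurve ℚ) 3 v : ℤ)) := by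
    rw [hδ]; exact hk
  exact bsdp_of_coveredRelativeAtThree_rankZero_of_not_split _ hA3 hWu hW16 hJs hJn hHs hHn hGZK hmod hpar hT hT' hAm
    hBm hF hGV hA7 hB _ _ 3 hGS hp3 hmult hns not_irreducible_110352bg1 hr hμ0 hlam hgood' hna' hμ0' hlam'
    three_not_mem_of_mem_S₀ (fun v hv h3 ↦ (RouteGSplitDisplay110352bg1.good_outside_S₀ v hv h3).1)
    (fun v hv h3 ↦ (RouteGSplitDisplay110352bg1.good_outside_S₀ v hv h3).2) torsionIso_110352bg1_36784bj1 hk' hn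

end Summit.BirchSwinnertonDyer.Rank1Residual.X2.RouteGSplitDisplay110352bg1AtThree

end
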